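import Mathlib
import Summits.ValiantsHypothesis.ValiantsHypothesis.Theses.GirthSidon

/-!
# `GirthSidon.Assembly` (stmt-ValiantsHypothesis-6545) — assembly of route GirthSidon

The route's assembly item `Assembly`:
`MomentCurveElusive → MomentCurveDefinable → (Raz 2010, §1 result 1 over ℂ, verbatim) →
ValiantsHypothesis`.

Pure bookkeeping, using the THIRD hypothesis (Raz's result 1, stated inline in the item exactly
as the tree's named fact `Literature.Computability.AlgebraicComplexity.Raz2010_result_1 ℂ`) and
no discharge of it: assume `VP ℂ = VNP ℂ`; then the permanent family is in `VP ℂ`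
(`perFamily_mem_VNP_holds`), hence `IsVPFamily (perPoly (Fin ·) ℂ)` (`mem_VP_ofFintype_iff_holds`),
in particular p-computable. Feed Raz's result 1 with `m(n) = 2^{10⌊n/36000⌋}`,
`s(n) = 2^{9⌊n/36000⌋}` (so `m(n)^9 = s(n)^10` on the nose and `m(n) ≥ n^c` eventually) and the
multilinearised B₃₀ power-sum moment curve (coordinate `i` is the bit monomial of
`d(m,i) = Σ_{k<60} (i+1)^k m^{60k} < m^{3600} ≤ 2ⁿ`): it is poly(`n`)-definable by
`MomentCurveDefinable`, of total degree `≤ n`, and eventually `(s(n), 2)`-elusive because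
`MomentCurveElusive` gives elusiveness of the curve `x ↦ (x^{d(m,i)})_i` at `m = m(n)`, which
transports to the multilinearisation along `x ↦ (x^{2^j})_j` (Raz 2010, Prop. 1.2, tree lemma
`eval_multilinMonomial`). Raz's conclusion `¬ IsPComputable (perPoly (Fin ·) ℂ)` is the
contradiction. (The route's deciding theorem `GirthSidon.closes` runs the same bookkeeping with the
tree discharge `Raz2010_result_1_holds` in place of the hypothesis.) [cite: Raz2010, §1 result 1,
Prop. 1.2]
-/

namespace Summit.ValiantsHypothesis.ValiantsHypothesis.Theorems

-- `Summit.ValiantsHypothesis.ValiantsHypothesis.…` is the tree's mandated single-conjunct layout (Sub = Summit).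
set_option linter.dupNamespace false

open Literature.Computability.AlgebraicComplexity in
/-- **`Assembly` holds** (item stmt-ValiantsHypothesis-6545, assembly of route GirthSidon):
`MomentCurveElusive → MomentCurveDefinable → (Raz 2010 §1 result 1 over ℂ, verbatim) →
ValiantsHypothesis`. Bookkeeping: from `VP ℂ = VNP ℂ` the permanent family is p-computable
(`perFamily_mem_VNP_holds`, `mem_VP_ofFintype_iff_holds`); Raz's result 1 (the hypothesis) applied
to the multilinearised moment curve with `m(n) = 2^{10⌊n/36000⌋}`, `s(n) = 2^{9⌊n/36000⌋}`
(definable by hypothesis 2, degree `≤ n`, eventually `(s(n),2)`-elusive by hypothesis 1 and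
Raz's Prop. 1.2 since the exponents are `< 2ⁿ`) says it is not. [cite: Raz2010, §1 result 1,
Prop. 1.2] -/
theorem girthSidon_assembly_proof :
    Summit.ValiantsHypothesis.ValiantsHypothesis.Theses.GirthSidon.Assembly := by
  unfold Summit.ValiantsHypothesis.ValiantsHypothesis.Theses.GirthSidon.Assembly
  intro h_MomentCurveElusive h_MomentCurveDefinable hRaz
  classical
  -- `ValiantsHypothesis` is `VP ℂ ≠ VNP ℂ`; assume equality and derive that `PER` is p-computable.
  show VP ℂ ≠ VNP ℂ
  intro hEq
  have hVP : perFamily ℂ ∈ VP ℂ := by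
    rw [hEq]; exact perFamily_mem_VNP_holds ℂ
  have hfam : IsVPFamily (fun n => perPoly (Fin n) ℂ) := (mem_VP_ofFintype_iff_holds _).1 hVP
  -- Raz 2010, §1 result 1 (the hypothesis `hRaz`), applied with
  -- `m(n) = 2^{10⌊n/36000⌋}`, `s(n) = 2^{9⌊n/36000⌋}` and the multilinearised moment curve.
  refine hRaz ?_ (fun n => 2 ^ (10 * (n / 36000))) (fun n => 2 ^ (9 * (n / 36000)))
    (fun n (i : Fin (2 ^ (10 * (n / 36000)))) => ∏ j : Fin n,
      (if Nat.testBit (∑ k ∈ Finset.range 60,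
          ((i : ℕ) + 1) ^ k * (2 ^ (10 * (n / 36000))) ^ (60 * k)) j
        then (MvPolynomial.X j : MvPolynomial (Fin n) ℂ) else 1))
    ?_ ?_ h_MomentCurveDefinable ?_ ?_ hfam.2
  · -- `char ℂ = 0 ≠ 2`
    rw [ringChar.eq_zero]; decide
  · -- `m(n) ≥ n^{ω(1)}`
    intro c
    obtain ⟨T, hT⟩ := eventually_mul_pow_lt_two_pow c (72000 ^ c)
    refine ⟨36000 * (T + 1), fun n hn => ?_⟩
    have ht : T ≤ n / 36000 := by omega
    have hn' : n ≤ 72000 * (n / 36000) := by omega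
    calc n ^ c ≤ (72000 * (n / 36000)) ^ c := Nat.pow_le_pow_left hn' c
      _ = 72000 ^ c * (n / 36000) ^ c := by rw [mul_pow]
      _ ≤ 2 ^ (n / 36000) := (hT _ ht).le
      _ ≤ 2 ^ (10 * (n / 36000)) := Nat.pow_le_pow_right (by norm_num) (by omega)
  · -- `s(n) ≥ m(n)^{0.9}`: `m^9 = 2^{90q} = s^10`
    exact ⟨0, fun n _ => by rw [← pow_mul, ← pow_mul]; exact le_of_eq (by ring_nf)⟩
  · -- degree `≤ n` (multilinear in `n` variables)
    exact IsPBounded.id.mono fun n =>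
      Finset.sup_le fun i _ => totalDegree_multilinMonomial_le (k := ℂ) n _
  · -- eventual `(s(n), 2)`-elusiveness: thesis X at `m = m(n)`, transported along Raz Prop. 1.2
    obtain ⟨m₀, hm₀⟩ := h_MomentCurveElusive
    refine ⟨36000 * (m₀ + 1), fun n hn => ?_⟩
    have hq1 : 1 ≤ n / 36000 := by omega
    have hqm : m₀ < n / 36000 := by omega
    have h36 : 36000 * (n / 36000) ≤ n := Nat.mul_div_le n 36000
    have hM : m₀ ≤ 2 ^ (10 * (n / 36000)) := by
      have h1 : n / 36000 < 2 ^ (n / 36000) := Nat.lt_two_pow_self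
      have h2 : 2 ^ (n / 36000) ≤ 2 ^ (10 * (n / 36000)) :=
        Nat.pow_le_pow_right (by norm_num) (by omega)
      omega
    have hS : (2 ^ (9 * (n / 36000))) ^ 10 ≤ (2 ^ (10 * (n / 36000))) ^ 9 := by
      rw [← pow_mul, ← pow_mul]; exact le_of_eq (by ring_nf)
    have hel := hm₀ (2 ^ (10 * (n / 36000))) hM (2 ^ (9 * (n / 36000))) hS
    -- the exponents are `< m^3600 ≤ 2^n`
    have hd : ∀ i : Fin (2 ^ (10 * (n / 36000))),
        (∑ k ∈ Finset.range 60, ((i : ℕ) + 1) ^ k * (2 ^ (10 * (n / 36000))) ^ (60 * k))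
          < 2 ^ n := by
      intro i
      have hi : (i : ℕ) + 1 ≤ 2 ^ (10 * (n / 36000)) := i.2
      have hterm : ∀ k ∈ Finset.range 60,
          ((i : ℕ) + 1) ^ k * (2 ^ (10 * (n / 36000))) ^ (60 * k)
            ≤ 2 ^ (35990 * (n / 36000)) := by
        intro k hk
        have hk' : k < 60 := Finset.mem_range.1 hk
        calc ((i : ℕ) + 1) ^ k * (2 ^ (10 * (n / 36000))) ^ (60 * k)
            ≤ (2 ^ (10 * (n / 36000))) ^ k * (2 ^ (10 * (n / 36000))) ^ (60 * k) :=
              Nat.mul_le_mul_right _ (Nat.pow_le_pow_left hi k)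
          _ = 2 ^ (10 * (n / 36000) * (k + 60 * k)) := by rw [← pow_add, ← pow_mul]
          _ ≤ 2 ^ (10 * (n / 36000) * 3599) :=
              Nat.pow_le_pow_right (by norm_num) (Nat.mul_le_mul_left _ (by omega))
          _ = 2 ^ (35990 * (n / 36000)) := by ring_nf
      calc (∑ k ∈ Finset.range 60, ((i : ℕ) + 1) ^ k * (2 ^ (10 * (n / 36000))) ^ (60 * k))
          ≤ ∑ _k ∈ Finset.range 60, 2 ^ (35990 * (n / 36000)) := Finset.sum_le_sum hterm
        _ = 60 * 2 ^ (35990 * (n / 36000)) := by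
            rw [Finset.sum_const, Finset.card_range, smul_eq_mul]
        _ < 2 ^ (35990 * (n / 36000) + 6) := by
            have := Nat.two_pow_pos (35990 * (n / 36000))
            rw [pow_add]; omega
        _ ≤ 2 ^ n := Nat.pow_le_pow_right (by norm_num) (by omega)
    -- Prop. 1.2: `Image (x ↦ (x^{d_i})_i) ⊆ Image (multilinearisation)` via `x ↦ (x^{2^j})_j`
    intro Γ hΓ hsub
    refine hel Γ hΓ (Set.Subset.trans ?_ hsub)
    rintro _ ⟨x, rfl⟩
    refine ⟨fun j => x 0 ^ 2 ^ (j : ℕ), funext fun i => ?_⟩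
    have key := eval_multilinMonomial (k := ℂ) (x 0) (hd i)
    simp only [polyMapEval_apply, MvPolynomial.eval_pow, MvPolynomial.eval_X]
    exact key

end Summit.ValiantsHypothesis.ValiantsHypothesis.Theorems
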